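import Literature.AnabelianGeometry.EtaleTheta.Discharge.Sec2OuterTransportModelKrull
import Literature.AnabelianGeometry.EtaleTheta.Discharge.Sec2SlimPiTpC
import Literature.AnabelianGeometry.EtaleTheta.SettingModelKrullCuspCommTerminal
import HarnessLib

/-!
# [EtTh] §2 at the cusped untwisted Krull model: `Π^tp_C` IS SLIM, and Rmk. 2.6.1 (dotted) / Cor. 2.9 at the κ′ cover
# with every cusp / cover / slimness binder DISCHARGED (residual = named facts only)

S. Mochizuki, *The étale theta function and its Frobenioid-theoretic manifestations*, Publ. RIMS **45** (2009) [EtTh], §2: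
Prop. 2.4 p. 38, Rmk. 2.6.1 p. 40 («`Aut_K(Ż) ≅ Aut_K(Z) × ℤ/2`»), Cor. 2.9 p. 43 («the set of cusps of … `(ℤ/lℤ)^±`»)
[cite: MochizukiEtTh2009, Cor 2.9 p.43]; slimness: [SemiAnbd] §3. Cell abc-iut, layer L2, seat abc-iut-L2-t10 (gen 6), Krull
row sequel K8 (self-named offer (a) of 13:02Z, abc-iut-L2-lead R373 «AVAILABLE-BY-NAME»). PROOF-ONLY (0 defs, no instance,
no new `Prop`): abc-iut-L2-d3's `Sec2SlimPiTpC` and abc-iut-L2-t7's `Sec2CoverModelOfCuspLaws` FIRED at K5b's C-level record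
`cLevelDataInvκ' p` over K4's carrier `PiCκ` (completion `toHatCκ`), where the inputs they name are THEOREMS of the model:
`op` (K3b), `CuspLaws` (`cuspLaws_modelκ'`), hιell (K6 `inv_ell_piCDataOf_toHatCκ`), L02 (`kerToZIsCompactlyGenerated_modelκ'`),
slimness of `Π^tp_X` (K3a `isSlimGroup_PiTpκ`), compact `D_x`, unique cusp.
* §1 **`isSlimGroup_PiCInvκ : IsSlimGroup (PiCInvκ p)`** — the TEMPERED `Π^tp_C = Π^tp_X ⋊_ι ℤ/2` of the model is SLIM
  (abc-iut-L2-d3's `CLevelData.isSlimGroup_GtpC`: slim `Π^tp_X` + «no element of `Π^tp_C ∖ Π^tp_X` centralises `Π^tp_X`»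
  from hιell at `l = 3`); the binder `hslim` of Rmk. 2.6.1 (dotted) / Cor. 2.9 at this model is thereby a theorem;
* §2 **the κ′ cover of record with Rmk. 2.6.1 (dotted) and Cor. 2.9** — `exists_temperedCoverData_rmk261_cor29_inversionModelκ'`:
  a `T : TemperedCoverData l` (odd `l ≠ 1`) with `T.toCoverDataAx =` the DERIVED `coverDataAx` on `PiCκ p` such that
  `T.Prop26 → T.Rmk261_dotted` and `T.Prop26 → IsoPreservesCuspidalDecomp → T.Cor29_card` — [SemiAnbd] Thm. 6.5 (ii)
  `DecompCommensurablyTerminal` being a THEOREM at this carrier (abc-iut-L2-t5 g7's R291 (A)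
  `isCommensurablyTerminal_decomp_modelκ'`, `SettingModelKrullCuspCommTerminal`; here `decompCommensurablyTerminal_curveκ'`);
  and the print-shaped count `exists_temperedCoverData_natCard_cuspOrbits_inversionModelκ'` («`(l+1)/2` orbits of cusps on each
  of the six members», given the cyclotome datum and `μ_l ⊆ K`). RESIDUAL = NAMED FACTS ONLY: [EtTh] Prop. 2.6 (F-0610, as
  `T.Prop26`), Thm. 6.5 (iii) (F-1674 `IsoPreservesCuspidalDecomp`), the cyclotome
  identification datum `CyclotomeMod 1 l` and `μ_l ⊆ K` (at `K = ℚ_p` and the UNTWISTED action both amount to `l ∣ p − 1`,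
  cf. K7 `toTheta_conj_eq_of_mem_deltaTheta_modelκ'`).
HONEST FRAMING: SEMI-SYNTHETIC model (untwisted Galois action; `Π^tp_C` of the MODEL, not of an orbicurve) — consistency /
non-vacuity evidence for the typed interface ONLY; FACT-LIST rows are consumed BY NAME, never discharged here; nothing of
[EtTh]/[SemiAnbd] is asserted; no side is taken on [IUTchIII] Cor. 3.12; typed ≠ proved; instantiated ≠ endorsed.
-/

noncomputable section

namespace Literature.AnabelianGeometry.EtaleTheta.SettingModel

open Literature.AnabelianGeometry.SemiGraphs ThetaCovers
open Literature.AlgebraicGeometry.Frobenioids (IsSlimGroup)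
open _root_.Topology _root_.Function

variable (p : ℕ) [Fact p.Prime]

/-! ## §1. The tempered `Π^tp_C` of the model is SLIM -/

/-- `3` is odd. [folklore] -/
private theorem odd_three : Odd (3 : ℕ) := ⟨1, rfl⟩

/-- **`Π^tp_C = Π^tp_X ⋊_ι ℤ/2` of the cusped untwisted Krull model is SLIM** (every open subgroup has trivial centraliser):
abc-iut-L2-d3's `CLevelData.isSlimGroup_GtpC` at `cLevelDataInvκ'` over K4's carrier, with `Π^tp_X` slim (K3a
`isSlimGroup_PiTpκ`) and hιell at `l = 3` (K6 `inv_ell_piCDataOf_toHatCκ`) — no binder. [cite: MochizukiEtTh2009, Prop 2.4 p.38] -/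
theorem isSlimGroup_PiCInvκ : IsSlimGroup (PiCInvκ p) := by
  obtain ⟨eX⟩ := nonempty_oncePuncturedData_modelκ' p
  exact (cLevelDataInvκ' p).isSlimGroup_GtpC (toHatCκ p) (isProfiniteCompletion_toHatCκ p) eX odd_three (by decide)
    (inv_ell_piCDataOf_toHatCκ p 3 eX) (isSlimGroup_PiTpκ p)

/-- The same, keyed on the `MuTwoSetting` (`(inversionModelκ' p).GtpC = PiCInvκ p`). [cite: MochizukiEtTh2009, Prop 2.4 p.38] -/
theorem isSlimGroup_GtpC_inversionModelκ' : IsSlimGroup (MuTwoSetting.inversionModelκ' p).GtpC :=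
  isSlimGroup_PiCInvκ p

/-- **[SemiAnbd] Thm. 6.5 (ii) at `modelκ′` in the `TemperedCurve` shape `DecompCommensurablyTerminal`** (`∀ x, Comm(D_x) = D_x`):
abc-iut-L2-t5 g7's `isCommensurablyTerminal_decomp_modelκ'` (R291 (A): `c^Ẑ` is commensurably terminal in `Γ` by [SemiAnbd]
Ex. 2.10 malnormality, transported to `D_x = c^Ẑ ⋊ G_{ℚ_p} ≤ Γ ⋊ G_{ℚ_p}`) re-keyed — the binder `h65` of the Cor. 2.9 knits
below is thereby a theorem. [cite: MochizukiSemiAnbd2006, Thm 6.5 (ii) p.71] -/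
theorem decompCommensurablyTerminal_curveκ' : (ThetaSetting.modelκ' p).toTemperedCurve.DecompCommensurablyTerminal :=
  fun x => (isCommensurablyTerminal_decomp_modelκ' p x).commensurator_eq

/-! ## §2. Rmk. 2.6.1 (dotted) and Cor. 2.9 at the κ′ cover — residual = named facts only -/

/-- **The κ′ cover of record, with [EtTh] Rmk. 2.6.1 (dotted) and Cor. 2.9 attached**: for odd `l ≠ 1` and once-punctured
parameters `eX` of `modelκ′` there is `T : TemperedCoverData l` whose profinite part IS the DERIVED `coverDataAx` on K4's
`PiCκ p` (splitting from the section of `CuspLaws` (C9), normalities from L02 — abc-iut-L2-t7's assembly) such that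
(i) `T.Prop26 → T.Rmk261_dotted` (abc-iut-f-144 / L2-d3, slimness DISCHARGED by §1) and
(ii) `T.Prop26 → IsoPreservesCuspidalDecomp → T.Cor29_card` (abc-iut-L2-d3's six-member Cor. 2.9; compact `D_x` = K3b
`isCompact_cuspDecompκ`, unique cusp = `Pt = Unit`, [SemiAnbd] Thm. 6.5 (ii) = `decompCommensurablyTerminal_curveκ'`). [cite: MochizukiEtTh2009, Cor 2.9 p.43] -/
theorem exists_temperedCoverData_rmk261_cor29_inversionModelκ' {l : ℕ} [NeZero l] (hodd : Odd l) (hl : l ≠ 1)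
    (eX : (ThetaSetting.modelκ' p).OncePuncturedData) :
    ∃ T : TemperedCoverData.{0} l,
      T.toCoverDataAx = ((cLevelDataInvκ' p).piCDataOf (toHatCκ p) (isProfiniteCompletion_toHatCκ p)).coverDataAx l eX
        (x := ()) trivial hodd (hIx_piCDataOf_toHatCκ p l hodd.pos eX ())
        (inv_ell_piCDataOf_toHatCκ p l eX) (inv_theta_piCDataOf_toHatCκ p l eX) ∧
      (T.Prop26 → T.Rmk261_dotted) ∧
      (T.Prop26 →
        (ThetaSetting.modelκ' p).toTemperedCurve.IsoPreservesCuspidalDecomp (ThetaSetting.modelκ' p).toTemperedCurve →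
        T.Cor29_card) := by
  obtain ⟨s, hs, hsa, hsc⟩ := (cuspLaws_modelκ' p).exists_section (x := ()) trivial
  refine ⟨(cLevelDataInvκ' p).temperedCoverData (toHatCκ p) (isProfiniteCompletion_toHatCκ p) (toHatCκ_injective p) eX hodd
      (x := ()) trivial (hIx_piCDataOf_toHatCκ p l hodd.pos eX ()) (inv_ell_piCDataOf_toHatCκ p l eX)
      ((cLevelDataInvκ' p).map_inclX_GtpXu_normal l (kerToZIsCompactlyGenerated_modelκ' p))
      ((cLevelDataInvκ' p).map_inclX_GtpY_normal (kerToZIsCompactlyGenerated_modelκ' p))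
      (((cLevelDataInvκ' p).piCDataOf (toHatCκ p) (isProfiniteCompletion_toHatCκ p)).isSplitting_of_section l eX
        (x := ()) trivial hodd _ (inv_ell_piCDataOf_toHatCκ p l eX) _ s hs hsa)
      (((cLevelDataInvκ' p).piCDataOf (toHatCκ p) (isProfiniteCompletion_toHatCκ p)).isClosed_splittingOfSection l eX s hsc),
    (cLevelDataInvκ' p).temperedCoverData_toCoverDataAx (toHatCκ p) (isProfiniteCompletion_toHatCκ p) (toHatCκ_injective p)
      eX hodd trivial _ (inv_ell_piCDataOf_toHatCκ p l eX) _ _ _ _,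
    fun h26 => ?_, fun h26 h65iii => ?_⟩
  · exact (cLevelDataInvκ' p).rmk261_dotted_ofSetting_of_slimX (toHatCκ p) (isProfiniteCompletion_toHatCκ p)
      (toHatCκ_injective p) eX hodd hl trivial _ (inv_ell_piCDataOf_toHatCκ p l eX) _ _ _ _ (isSlimGroup_PiTpκ p) h26
  · exact (cLevelDataInvκ' p).temperedCoverData_cor29_card_of_slimX (toHatCκ p) (isProfiniteCompletion_toHatCκ p)
      (toHatCκ_injective p) eX hodd hl trivial _ (inv_ell_piCDataOf_toHatCκ p l eX) _ _ _ _ (isSlimGroup_PiTpκ p) h26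
      (isCompact_cuspDecompκ p) (decompCommensurablyTerminal_curveκ' p) (fun x' _ => Subsingleton.elim x' ()) h65iii

/-- **[EtTh] Cor. 2.9 in print's shape at the κ′ cover — «each of the six members `Ẋ̲̲, Ċ̲, Ċ̲̲, X̲̲, C̲, C̲̲` has `(l+1)/2`
`Aut_K(−)`-orbits of cusps»** (abc-iut-L2-t7's END KNIT `exists_temperedCoverData_natCard_cuspOrbits_of_cuspLaws` at
`cLevelDataInvκ'` over K4's carrier): every cusp / cover / slimness / section / normality input is a THEOREM of the model;
RESIDUAL = {`T.Prop26` (F-0610), `IsoPreservesCuspidalDecomp` (F-1674), the cyclotome datum `CyclotomeMod 1 l`, `μ_l ⊆ K = ℚ_p`}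
([SemiAnbd] Thm. 6.5 (ii) discharged by `decompCommensurablyTerminal_curveκ'`).
[cite: MochizukiEtTh2009, Cor 2.9 p.43] -/
theorem exists_temperedCoverData_natCard_cuspOrbits_inversionModelκ' {l : ℕ+} (hodd : Odd (l : ℕ)) (hl : (l : ℕ) ≠ 1)
    (eX : (ThetaSetting.modelκ' p).OncePuncturedData)
    (h65iii : (ThetaSetting.modelκ' p).toTemperedCurve.IsoPreservesCuspidalDecomp (ThetaSetting.modelκ' p).toTemperedCurve)
    (μ : (ThetaSetting.modelκ' p).CyclotomeMod 1 l)
    (hμK : ∀ ζ : MuN p l, (((ζ : (PadicAlgCl p)ˣ) : PadicAlgCl p)) ∈ (ThetaSetting.modelκ' p).K) :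
    ∃ T : TemperedCoverData.{0} l,
      T.toCoverDataAx = ((cLevelDataInvκ' p).piCDataOf (toHatCκ p) (isProfiniteCompletion_toHatCκ p)).coverDataAx l eX
        (x := ()) trivial hodd (hIx_piCDataOf_toHatCκ p l hodd.pos eX ())
        (inv_ell_piCDataOf_toHatCκ p l eX) (inv_theta_piCDataOf_toHatCκ p l eX) ∧
      (T.Prop26 → ∀ S' ∈ [T.tp T.PiXuu ⊓ T.PiCdot, T.tp T.PiCu ⊓ T.PiCdot, T.tp T.PiCuu ⊓ T.PiCdot,
          T.tp T.PiXuu, T.tp T.PiCu, T.tp T.PiCuu], Nat.card (T.cuspOrbits S') = ((l : ℕ) + 1) / 2) :=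
  (cLevelDataInvκ' p).exists_temperedCoverData_natCard_cuspOrbits_of_cuspLaws (toHatCκ p) (isProfiniteCompletion_toHatCκ p)
    (toHatCκ_injective p) eX (cuspLaws_modelκ' p) hodd hl (x := ()) trivial (inv_ell_piCDataOf_toHatCκ p l eX)
    (kerToZIsCompactlyGenerated_modelκ' p) (isSlimGroup_PiTpκ p) (decompCommensurablyTerminal_curveκ' p) h65iii μ hμK

/-- **Census form**: for odd `l ≠ 1`, `TemperedCoverData l` is inhabited at `modelκ′` by a cover for which Rmk. 2.6.1 (dotted)
holds GIVEN ONLY Prop. 2.6, and Cor. 2.9 GIVEN ONLY {Prop. 2.6, [SemiAnbd] Thm. 6.5 (iii)}.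
[cite: MochizukiEtTh2009, Rmk 2.6.1 p.40] -/
theorem exists_temperedCoverData_rmk261_of_prop26_inversionModelκ' {l : ℕ} [NeZero l] (hodd : Odd l) (hl : l ≠ 1) :
    ∃ T : TemperedCoverData.{0} l, (T.Prop26 → T.Rmk261_dotted) ∧
      (T.Prop26 →
        (ThetaSetting.modelκ' p).toTemperedCurve.IsoPreservesCuspidalDecomp (ThetaSetting.modelκ' p).toTemperedCurve →
        T.Cor29_card) := by
  obtain ⟨eX⟩ := nonempty_oncePuncturedData_modelκ' p
  obtain ⟨T, -, h₁, h₂⟩ := exists_temperedCoverData_rmk261_cor29_inversionModelκ' p hodd hl eX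
  exact ⟨T, h₁, h₂⟩

end Literature.AnabelianGeometry.EtaleTheta.SettingModel

end
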